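import Mathlib.Analysis.Calculus.ParametricIntegral
import Literature.Analysis.FluidPDE.PassiveScalarClassicalEnergy
import Literature.Analysis.FunctionSpaces.TorusConvolution
import HarnessLib

/-!
# The two-point pair functional along a classical advection–diffusion

Analysis/FluidPDE proof-support file (everything proved). For a classical solution `χ` of
`∂ₜχ + v·∇χ = κΔχ` on `[0,T] × T^d` (smooth divergence-free drift `v`) and a smooth **even**
kernel `φ : T^d → ℝ`, the quadratic two-point functional

  `F(τ) = ∫∫ φ(x - y) χ(τ,x) χ(τ,y) dx dy`

(the pairing of the product `χ ⊗ χ`, which solves the doubled equation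
`∂ₜΘ + v(x)·∇ₓΘ + v(y)·∇_yΘ = κ(Δₓ + Δ_y)Θ` on `T^d × T^d`, against the cost `φ(x - y)`) satisfies

  `F(T) - F(0) = ∫₀ᵀ 2 ∫ χ(τ,x) ∫ χ(τ,y) (κ Δφ(x - y) + v(τ,x)·∇φ(x - y)) dy dx dτ`

(`IsClassicalScalarTransportOn.pair_functional_sub_eq`): differentiate under the integral,
use the equation, and move the derivatives onto `φ` through the convolution `χ(τ) ⋆ φ`
(`∫ (Δχ) A = ∫ χ ΔA`, `∫ (v·∇χ) A = -∫ χ v·∇A`, `Δ(χ ⋆ φ) = χ ⋆ Δφ`, `∇(χ ⋆ φ) = χ ⋆ ∇φ`).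
This is the Eulerian form of the evolution of a two-particle observable used in two-point
(Crippa–De Lellis / Seis type) dissipation and mixing estimates; with the odd gradient of an even
`φ` the drift term symmetrises to `∫∫ χχ (v(x) - v(y))·∇φ(x - y)`, see the users of this file.

## References

* C. Seis, *Bounds on the rate of enhanced dissipation*, Comm. Math. Phys. 399 (2023) =
  arXiv:2003.08794, Lemma 3 (rate of change of a transport functional along the
  advection–diffusion equation). [`Seis2022`]
* L. C. Evans, *Partial Differential Equations*, 2nd ed. (2010), App. C.4, Thm. 7 (derivatives of
  mollifications). [`Evans2010`]
-/

noncomputable section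

open MeasureTheory Set Filter Topology Function Metric
open scoped InnerProductSpace ContDiff Convolution
open Literature.Analysis.FunctionSpaces Literature.Analysis.FunctionSpaces.Torus

namespace Literature.Analysis.FluidPDE

namespace Torus

variable {d : Type*} [Fintype d] [DecidableEq d]

/-! ## Integrals over `T^d × T^d` -/

omit [DecidableEq d] in
/-- A continuous function on the compact probability space `T^d × T^d` is integrable. [folklore] -/
theorem integrable_prod_of_continuous {G : UnitAddTorus d × UnitAddTorus d → ℝ} (hG : Continuous G) :
    Integrable G (volume : Measure (UnitAddTorus d × UnitAddTorus d)) := by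
  obtain ⟨C, hC⟩ := isCompact_univ.exists_bound_of_continuousOn hG.continuousOn
  exact Integrable.mono' (integrable_const C) hG.aestronglyMeasurable
    (Eventually.of_forall fun p => hC p (mem_univ p))

omit [DecidableEq d] in
/-- Iterated form of the integral of a continuous function over `T^d × T^d`. [folklore] -/
theorem integral_prod_of_continuous {G : UnitAddTorus d × UnitAddTorus d → ℝ} (hG : Continuous G) :
    ∫ p, G p = ∫ x, ∫ y, G (x, y) :=
  integral_prod G (integrable_prod_of_continuous hG)

/-! ## The slice identity: moving the generator onto the kernel -/

omit [DecidableEq d] in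
/-- The convolution as an integral: `(f ⋆ φ)(x) = ∫ f y φ(x - y) dy`. [folklore] -/
theorem convolution_apply_eq (f φ : UnitAddTorus d → ℝ) (x : UnitAddTorus d) :
    (f ⋆ φ) x = ∫ y, f y * φ (x - y) := by
  rw [convolution_lsmul]; rfl

/-- **The slice identity.** For smooth `f`, a smooth divergence-free `w`, a smooth even `φ` and
`D = κΔf - w·∇f` (the time derivative given by the equation):
`∫∫ φ(x-y) (D(x) f(y) + f(x) D(y)) = 2 ∫ f(x) ∫ f(y) (κ Δφ(x-y) + w(x)·∇φ(x-y))`. [folklore] -/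
theorem integral_integral_pair_deriv_eq {f φ : UnitAddTorus d → ℝ} {w : UnitAddTorus d → EuclideanSpace ℝ d}
    (hf : IsSmooth f) (hw : IsSmooth w) (hdiv : IsDivFree w) (hφ : IsSmooth φ) (hφe : ∀ z, φ (-z) = φ z) (κ : ℝ) :
    ∫ x, ∫ y, φ (x - y) * ((κ * laplacian f x - ⟪w x, gradient f x⟫_ℝ) * f y +
        f x * (κ * laplacian f y - ⟪w y, gradient f y⟫_ℝ)) =
      2 * ∫ x, f x * ∫ y, f y * (κ * laplacian φ (x - y) + ⟪w x, gradient φ (x - y)⟫_ℝ) := by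
  -- the generator slice `D` and the convolution `A = f ⋆ φ`
  set D : UnitAddTorus d → ℝ := fun x => κ * laplacian f x - ⟪w x, gradient f x⟫_ℝ with hD
  have hDs : IsSmooth D := (hf.laplacian.smul κ).sub (hw.inner hf.gradient)
  have hDc : Continuous D := hDs.continuous
  have hfc : Continuous f := hf.continuous
  have hφc : Continuous φ := hφ.continuous
  have hfi : Integrable f volume := hf.integrable
  set A : UnitAddTorus d → ℝ := f ⋆ φ with hA
  have hAs : IsSmooth A := isSmooth_convolution hfi hφ
  have hAx : ∀ x, A x = ∫ y, f y * φ (x - y) := fun x => convolution_apply_eq f φ x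
  -- first term: `∫∫ φ(x-y) D(x) f(y) = ∫ D A`
  have h1 : ∫ x, ∫ y, φ (x - y) * (D x * f y) = ∫ x, D x * A x := by
    refine integral_congr_ae (Eventually.of_forall fun x => ?_)
    simp only
    rw [hAx x, ← integral_const_mul]
    exact integral_congr_ae (Eventually.of_forall fun y => by ring)
  -- second term: swap and use evenness
  have h2 : ∫ x, ∫ y, φ (x - y) * (f x * D y) = ∫ y, D y * A y := by
    have hcont : Continuous (uncurry fun x y => φ (x - y) * (f x * D y)) :=
      (hφc.comp (continuous_fst.sub continuous_snd)).mul
        ((hfc.comp continuous_fst).mul (hDc.comp continuous_snd))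
    rw [integral_integral_swap (integrable_prod_of_continuous hcont)]
    refine integral_congr_ae (Eventually.of_forall fun y => ?_)
    simp only
    rw [hAx y, ← integral_const_mul]
    refine integral_congr_ae (Eventually.of_forall fun x => ?_)
    have : φ (x - y) = φ (y - x) := by rw [← hφe (x - y), neg_sub]
    show φ (x - y) * (f x * D y) = D y * (f x * φ (y - x))
    rw [this]; ring
  -- split the integrand
  have hsplit : ∀ x, ∫ y, φ (x - y) * (D x * f y + f x * D y) =
      (∫ y, φ (x - y) * (D x * f y)) + ∫ y, φ (x - y) * (f x * D y) := by
    intro x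
    have hφx : Continuous fun y => φ (x - y) := hφc.comp (continuous_const.sub continuous_id)
    have i1 : Integrable (fun y => φ (x - y) * (D x * f y)) volume :=
      (hφx.mul (continuous_const.mul hfc)).integrable_unitAddTorus
    have i2 : Integrable (fun y => φ (x - y) * (f x * D y)) volume :=
      (hφx.mul (continuous_const.mul hDc)).integrable_unitAddTorus
    rw [← integral_add i1 i2]
    exact integral_congr_ae (Eventually.of_forall fun y => by ring)
  have hI1 : Integrable (fun x => ∫ y, φ (x - y) * (D x * f y)) volume := by
    have hcont : Continuous (uncurry fun x y => φ (x - y) * (D x * f y)) :=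
      (hφc.comp (continuous_fst.sub continuous_snd)).mul
        ((hDc.comp continuous_fst).mul (hfc.comp continuous_snd))
    exact (integrable_prod_of_continuous hcont).integral_prod_left
  have hI2 : Integrable (fun x => ∫ y, φ (x - y) * (f x * D y)) volume := by
    have hcont : Continuous (uncurry fun x y => φ (x - y) * (f x * D y)) :=
      (hφc.comp (continuous_fst.sub continuous_snd)).mul
        ((hfc.comp continuous_fst).mul (hDc.comp continuous_snd))
    exact (integrable_prod_of_continuous hcont).integral_prod_left
  have hLHS : ∫ x, ∫ y, φ (x - y) * (D x * f y + f x * D y) = 2 * ∫ x, D x * A x := by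
    simp_rw [hsplit]
    rw [integral_add hI1 hI2, h1, h2]; ring
  -- move the generator onto `A`: `∫ D A = κ ∫ f ΔA + ∫ f w·∇A`
  have hDA : ∫ x, D x * A x = ∫ x, f x * (κ * laplacian A x + ⟪w x, gradient A x⟫_ℝ) := by
    have i1 : Integrable (fun x => laplacian f x * A x) volume := (hf.laplacian.smul' hAs).integrable
    have i2 : Integrable (fun x => ⟪w x, gradient f x⟫_ℝ * A x) volume := ((hw.inner hf.gradient).smul' hAs).integrable
    have i3 : Integrable (fun x => κ * (f x * laplacian A x)) volume := (hf.smul' hAs.laplacian).integrable.const_mul κ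
    have i4 : Integrable (fun x => f x * ⟪w x, gradient A x⟫_ℝ) volume := (hf.smul' (hw.inner hAs.gradient)).integrable
    have e1 : ∫ x, D x * A x = κ * (∫ x, laplacian f x * A x) - ∫ x, ⟪w x, gradient f x⟫_ℝ * A x := by
      rw [← integral_const_mul, ← integral_sub (i1.const_mul κ) i2]
      exact integral_congr_ae (Eventually.of_forall fun x => by simp only [hD]; ring)
    have e2 : ∫ x, laplacian f x * A x = ∫ x, f x * laplacian A x := by
      rw [FunctionSpaces.Torus.integral_mul_laplacian_comm_holds hf hAs]
    have e3 : ∫ x, ⟪w x, gradient f x⟫_ℝ * A x = -∫ x, f x * ⟪w x, gradient A x⟫_ℝ := by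
      have := integral_mul_inner_gradient_add_eq_zero hw hdiv hf hAs
      linarith
    rw [e1, e2, e3, sub_neg_eq_add, ← integral_const_mul, ← integral_add i3 i4]
    exact integral_congr_ae (Eventually.of_forall fun x => by simp only; ring)
  -- the derivatives of the convolution
  have hlap : ∀ x, laplacian A x = ∫ y, f y * laplacian φ (x - y) := fun x => by
    rw [hA, laplacian_convolution hfi hφ x, convolution_apply_eq]
  have hgrad : ∀ x, ⟪w x, gradient A x⟫_ℝ = ∫ y, f y * ⟪w x, gradient φ (x - y)⟫_ℝ := fun x => by
    rw [hA, gradient_convolution hfi hφ x, convolution_lsmul,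
      ← integral_inner (integrable_smul_comp_sub hfi hφ.gradient.continuous x)]
    exact integral_congr_ae (Eventually.of_forall fun y => by
      show ⟪w x, f y • Torus.gradient φ (x - y)⟫_ℝ = f y * ⟪w x, Torus.gradient φ (x - y)⟫_ℝ
      rw [real_inner_smul_right])
  rw [hLHS, hDA]
  congr 1
  refine integral_congr_ae (Eventually.of_forall fun x => ?_)
  simp only
  rw [hlap x, hgrad x, ← integral_const_mul, ← integral_add]
  · congr 1
    exact integral_congr_ae (Eventually.of_forall fun y => by ring)
  · exact ((hfc.mul ((hφ.laplacian.continuous).comp (continuous_const.sub continuous_id))).integrable_unitAddTorus).const_mul κ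
  · exact (hfc.mul (continuous_const.inner
      (hφ.gradient.continuous.comp (continuous_const.sub continuous_id)))).integrable_unitAddTorus

/-! ## The evolution identity -/

namespace IsClassicalScalarTransportOn

variable {κ T : ℝ} {v : ℝ → UnitAddTorus d → EuclideanSpace ℝ d} {χ : ℝ → UnitAddTorus d → ℝ}
  {φ : UnitAddTorus d → ℝ}

/-- **Evolution of the two-point pair functional** along a classical solution `χ` of
`∂ₜχ + v·∇χ = κΔχ` on `[0,T]`, for a smooth even kernel `φ`:
`∫∫ φ(x-y)χ(T,x)χ(T,y) - ∫∫ φ(x-y)χ(0,x)χ(0,y)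
  = ∫₀ᵀ 2 ∫ χ(τ,x) ∫ χ(τ,y) (κ Δφ(x-y) + v(τ,x)·∇φ(x-y)) dy dx dτ`. [folklore] -/
theorem pair_functional_sub_eq (hT : 0 < T) (h : IsClassicalScalarTransportOn (Icc 0 T) κ v χ)
    (hφ : IsSmooth φ) (hφe : ∀ z, φ (-z) = φ z) :
    (∫ x, ∫ y, φ (x - y) * (χ T x * χ T y)) - (∫ x, ∫ y, φ (x - y) * (χ 0 x * χ 0 y)) =
      ∫ τ in (0 : ℝ)..T, 2 * ∫ x, χ τ x * ∫ y, χ τ y *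
        (κ * laplacian φ (x - y) + ⟪v τ x, gradient φ (x - y)⟫_ℝ) := by
  have hU : UniqueDiffOn ℝ (Icc 0 T) := uniqueDiffOn_Icc hT
  have hχs := h.smooth_scalar
  set Dχ : ℝ → UnitAddTorus d → ℝ := timeDerivWithin (Icc 0 T) χ with hDχ
  have hDs : IsSmoothSpaceTimeOn (Icc 0 T) Dχ := hχs.timeDerivWithin hU
  have hφc : Continuous φ := hφ.continuous
  -- uniform bounds on `[0,T] × T^d`
  obtain ⟨Cχ, hCχ⟩ := hχs.exists_norm_le_of_isCompact isCompact_Icc subset_rfl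
  obtain ⟨CD, hCD⟩ := hDs.exists_norm_le_of_isCompact isCompact_Icc subset_rfl
  obtain ⟨Cφ, hCφ⟩ := isCompact_univ.exists_bound_of_continuousOn hφc.continuousOn
  have hCχ0 : 0 ≤ Cχ := (norm_nonneg _).trans (hCχ 0 (left_mem_Icc.2 hT.le) 0)
  have hCD0 : 0 ≤ CD := (norm_nonneg _).trans (hCD 0 (left_mem_Icc.2 hT.le) 0)
  have hCφ0 : 0 ≤ Cφ := (norm_nonneg _).trans (hCφ 0 (mem_univ _))
  -- the integrands on `T^d × T^d`
  set G : ℝ → UnitAddTorus d × UnitAddTorus d → ℝ := fun σ p => φ (p.1 - p.2) * (χ σ p.1 * χ σ p.2) with hG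
  set G' : ℝ → UnitAddTorus d × UnitAddTorus d → ℝ :=
    fun σ p => φ (p.1 - p.2) * (Dχ σ p.1 * χ σ p.2 + χ σ p.1 * Dχ σ p.2) with hG'
  have hslice : ∀ σ ∈ Icc 0 T, Continuous (χ σ) := fun σ hσ => (hχs.isSmooth_slice hσ).continuous
  have hsliceD : ∀ σ ∈ Icc 0 T, Continuous (Dχ σ) := fun σ hσ => (hDs.isSmooth_slice hσ).continuous
  have hφp : Continuous fun p : UnitAddTorus d × UnitAddTorus d => φ (p.1 - p.2) :=
    hφc.comp (continuous_fst.sub continuous_snd)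
  have hGc : ∀ σ ∈ Icc 0 T, Continuous (G σ) := fun σ hσ =>
    hφp.mul (((hslice σ hσ).comp continuous_fst).mul ((hslice σ hσ).comp continuous_snd))
  have hG'c : ∀ σ ∈ Icc 0 T, Continuous (G' σ) := fun σ hσ =>
    hφp.mul ((((hsliceD σ hσ).comp continuous_fst).mul ((hslice σ hσ).comp continuous_snd)).add
      (((hslice σ hσ).comp continuous_fst).mul ((hsliceD σ hσ).comp continuous_snd)))
  have hGbd : ∀ σ ∈ Icc 0 T, ∀ p, ‖G σ p‖ ≤ Cφ * (Cχ * Cχ) := by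
    intro σ hσ p
    simp only [hG, norm_mul]
    exact mul_le_mul (hCφ _ (mem_univ _)) (mul_le_mul (hCχ σ hσ _) (hCχ σ hσ _) (norm_nonneg _) hCχ0)
      (by positivity) hCφ0
  have hG'bd : ∀ σ ∈ Icc 0 T, ∀ p, ‖G' σ p‖ ≤ Cφ * (CD * Cχ + Cχ * CD) := by
    intro σ hσ p
    simp only [hG', norm_mul]
    refine mul_le_mul (hCφ _ (mem_univ _)) ((norm_add_le _ _).trans (add_le_add ?_ ?_)) (norm_nonneg _) hCφ0
    · rw [norm_mul]; exact mul_le_mul (hCD σ hσ _) (hCχ σ hσ _) (norm_nonneg _) hCD0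
    · rw [norm_mul]; exact mul_le_mul (hCχ σ hσ _) (hCD σ hσ _) (norm_nonneg _) hCχ0
  -- pointwise time derivatives
  have hderiv_pt : ∀ σ ∈ Ioo 0 T, ∀ p, HasDerivAt (fun σ => G σ p) (G' σ p) σ := by
    intro σ hσ p
    have hσ' : σ ∈ Icc 0 T := Ioo_subset_Icc_self hσ
    have hn : Icc 0 T ∈ 𝓝 σ := Icc_mem_nhds hσ.1 hσ.2
    have h1 : HasDerivAt (fun σ => χ σ p.1) (Dχ σ p.1) σ := (hχs.hasDerivWithinAt_slice hσ' p.1).hasDerivAt hn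
    have h2 : HasDerivAt (fun σ => χ σ p.2) (Dχ σ p.2) σ := (hχs.hasDerivWithinAt_slice hσ' p.2).hasDerivAt hn
    have h12 : HasDerivAt (fun σ => χ σ p.1 * χ σ p.2) (Dχ σ p.1 * χ σ p.2 + χ σ p.1 * Dχ σ p.2) σ := h1.mul h2
    exact h12.const_mul (φ (p.1 - p.2))
  have hcont_pt : ∀ p, ContinuousOn (fun σ => G σ p) (Icc 0 T) := by
    intro p σ hσ
    have h1 := (hχs.hasDerivWithinAt_slice hσ p.1).continuousWithinAt
    have h2 := (hχs.hasDerivWithinAt_slice hσ p.2).continuousWithinAt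
    exact ((h1.mul h2).const_mul (φ (p.1 - p.2)) : _)
  have hcont_pt' : ∀ p, ContinuousOn (fun σ => G' σ p) (Icc 0 T) := by
    intro p σ hσ
    have h1 := (hχs.hasDerivWithinAt_slice hσ p.1).continuousWithinAt
    have h2 := (hχs.hasDerivWithinAt_slice hσ p.2).continuousWithinAt
    have h3 := (hDs.hasDerivWithinAt_slice hσ p.1).continuousWithinAt
    have h4 := (hDs.hasDerivWithinAt_slice hσ p.2).continuousWithinAt
    exact (((h3.mul h2).add (h1.mul h4)).const_mul (φ (p.1 - p.2)) : _)
  -- `F` and `F'`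
  set F : ℝ → ℝ := fun σ => ∫ p, G σ p with hF
  set F' : ℝ → ℝ := fun σ => ∫ p, G' σ p with hF'
  have hFcont : ContinuousOn F (Icc 0 T) :=
    continuousOn_of_dominated (bound := fun _ => Cφ * (Cχ * Cχ))
      (fun σ hσ => (hGc σ hσ).aestronglyMeasurable)
      (fun σ hσ => Eventually.of_forall (hGbd σ hσ)) (integrable_const _)
      (Eventually.of_forall hcont_pt)
  have hF'cont : ContinuousOn F' (Icc 0 T) :=
    continuousOn_of_dominated (bound := fun _ => Cφ * (CD * Cχ + Cχ * CD))
      (fun σ hσ => (hG'c σ hσ).aestronglyMeasurable)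
      (fun σ hσ => Eventually.of_forall (hG'bd σ hσ)) (integrable_const _)
      (Eventually.of_forall hcont_pt')
  have hFderiv : ∀ τ ∈ Ioo 0 T, HasDerivAt F (F' τ) τ := by
    intro τ hτ
    have hmeas : ∀ᶠ σ in 𝓝 τ, AEStronglyMeasurable (G σ) volume := by
      filter_upwards [Ioo_mem_nhds hτ.1 hτ.2] with σ hσ
      exact (hGc σ (Ioo_subset_Icc_self hσ)).aestronglyMeasurable
    exact (hasDerivAt_integral_of_dominated_loc_of_deriv_le (Ioo_mem_nhds hτ.1 hτ.2) hmeas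
      (integrable_prod_of_continuous (hGc τ (Ioo_subset_Icc_self hτ)))
      (hG'c τ (Ioo_subset_Icc_self hτ)).aestronglyMeasurable
      (Eventually.of_forall fun p σ hσ => hG'bd σ (Ioo_subset_Icc_self hσ) p)
      (integrable_const _)
      (Eventually.of_forall fun p σ hσ => hderiv_pt σ hσ p)).2
  -- the fundamental theorem of calculus
  have hFTC := intervalIntegral.integral_eq_sub_of_hasDerivAt_of_le hT.le hFcont hFderiv
    (hF'cont.intervalIntegrable_of_Icc hT.le)
  -- identify `F T`, `F 0` and `F' τ`
  have hFeq : ∀ σ ∈ Icc 0 T, F σ = ∫ x, ∫ y, φ (x - y) * (χ σ x * χ σ y) := fun σ hσ =>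
    integral_prod_of_continuous (hGc σ hσ)
  have hF'eq : ∀ τ ∈ Icc 0 T, F' τ = 2 * ∫ x, χ τ x * ∫ y, χ τ y *
      (κ * laplacian φ (x - y) + ⟪v τ x, gradient φ (x - y)⟫_ℝ) := by
    intro τ hτ
    have hfτ : IsSmooth (χ τ) := hχs.isSmooth_slice hτ
    have hvτ : IsSmooth (v τ) := h.smooth_velocity.isSmooth_slice hτ
    have hDeq : ∀ x, Dχ τ x = κ * laplacian (χ τ) x - ⟪v τ x, gradient (χ τ) x⟫_ℝ := fun x => by
      have := h.transport τ hτ x; simp only [hDχ]; linarith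
    show (∫ p, G' τ p) = _
    rw [integral_prod_of_continuous (hG'c τ hτ)]
    simp only [hG', hDeq]
    exact integral_integral_pair_deriv_eq hfτ hvτ (h.divFree τ hτ) hφ hφe κ
  rw [hFeq T (right_mem_Icc.2 hT.le), hFeq 0 (left_mem_Icc.2 hT.le)] at hFTC
  rw [← hFTC]
  refine intervalIntegral.integral_congr fun τ hτ => ?_
  rw [uIcc_of_le hT.le] at hτ
  exact hF'eq τ hτ

end IsClassicalScalarTransportOn

end Torus

end Literature.Analysis.FluidPDE
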